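import Summits.PneNP.PneNP.Theses.Circuit2
import Summits.PneNP.PneNP.Theses.Circuit
import Summits.PneNP.PneNP.Theorems.Circuit2CircuitMagnificationGlue
import Summits.PneNP.PneNP.Theorems.Circuit2CircuitMcspGlue
import Summits.PneNP.PneNP.Theorems.SzkEntropyPhCollapse
import Literature.Computability.Complexity.KarpLipton
import Literature.Computability.Complexity.PolyAdvicePH
import Literature.Computability.Complexity.StructuralPHProofs
import Literature.Computability.Complexity.ClayProblemProofs
import Literature.Computability.Complexity.ExpTimeCollapsesProofs
import Literature.Computability.Complexity.ExpClosure
import Literature.Computability.Complexity.SipserGacsLautemann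
import Literature.Computability.Complexity.ACC0SubsetPPoly
import Literature.Computability.Complexity.TC0SubsetNC1
import Literature.Computability.Cryptography.OneWayFunctionsPPoly
import Literature.Barriers.PneNP.NaturalProofsHardPRGStrength

/-!
# STRATEGY CENSUS (typed companion) — crux `Circuit2.CircuitThesis` (stmt-PneNP-10624)

Unit `cstrat-stmt-PneNP-10624-r1` (crux-strategist, RESTATED deciding crux, BC2-redirect audit).
`X := CircuitThesis = ¬ (NP ⊆ P/poly)`, `S := PneNP`.  The question put to this seat: is there a
typed decomposition `X₁ ∧ … ∧ X_k → X` (k ≥ 2) with (a) every piece load-bearing, (b) a NON-TRIVIAL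
proved assembly, (c) no piece equivalent to `X` or to `S` (and no piece at least `X` / at least `S`)?

This file kernel-checks the LAWS that organise the census (`STRATEGY-CENSUS.md` next to it) and the
disqualifying implications for every candidate piece that was tried.  Everything is sorry-free over
LANDED modules; nothing here is a new conjecture.

* §1  four laws of two-piece decompositions of `X` (pure logic + the route's `closes`).
* §2  consequences of `¬ S` (Cook's `P = NP`) in the tree: `NP ⊆ P`, `PH ⊆ P`, `BPP ⊆ P`,
      `EXP ⊄ P/poly` (Meyer + `P ≠ EXP`), hence crux #4 `CircuitNexpNotPpoly` — these pieces trigger LAW A.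
* §3  pieces that are AT LEAST `X` by a landed theorem (LAW B): #2, #5R, `PH ≠ Σ₂ᵖ`, hard PRGs, non-uniform OWFs.
* §4  pieces EQUIVALENT to `X` by a landed iff (criterion (c)): `SAT ∉ P/poly`, `PH ⊄ P/poly`, `Σ₂ᵖ ⊄ P/poly`,
      `¬ CircuitNeg`, the two `NPNotSubsetPPoly` constants.
* §5  admissible pieces (strict consequences of `X`: fixed-polynomial, `TC⁰`, `ACC⁰`, `NEXP`, quadratic-SAT) and
      the computation that their weakest partner is `X ∨ ¬piece`, assembled by ONE application (criterion (b)).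
* §6  the squeeze register: every landed collapse-consequence of `¬ X`, with the lower-bound jaw it would need.
* §7  case splits with k ≥ 3 pieces: `X ↔ S ∧ ConverseKarpLipton`, and splitting `S` along any `D` is propositional.
-/

set_option linter.dupNamespace false
set_option autoImplicit false

namespace Summit.PneNP.PneNP.Cruxes.CircuitThesis.StrategyCensus

open Literature.Computability.Complexity
open Summit.PneNP.PneNP.Theses

/-- The crux under audit, by name. -/
abbrev X : Prop := Circuit2.CircuitThesis

theorem X_def : X ↔ ¬ (Nondeterministic.NP ⊆ PPoly) := Iff.rfl

/-- The summit follows from the crux: the route's deciding theorem (Circuit2.lean:326). -/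
theorem S_of_X (h : X) : _root_.PneNP := Circuit2.closes h

/-! ## §1 Laws of two-piece decompositions `F₁ ∧ F₂ → X` -/

/-- **LAW 0 (case-split normal form).** A two-piece assembly is exactly the statement that the second
piece carries the transfer `F₁ → X`; read with the roles swapped it is a case split on `F₁`. -/
theorem law0_normal_form (F₁ F₂ : Prop) : (F₁ ∧ F₂ → X) ↔ (F₂ → (F₁ → X)) := by
  constructor
  · exact fun h h₂ h₁ => h ⟨h₁, h₂⟩
  · exact fun h hp => h hp.2 hp.1

/-- **LAW A (summit leakage).** If one piece holds in every `P = NP` world (it follows from `¬ S`), then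
its partner alone decides the summit — the partner violates criterion (c) ("at least `S`"). -/
theorem lawA_summit_leakage {F₁ F₂ : Prop} (h₁ : ¬ _root_.PneNP → F₁) (hasm : F₁ ∧ F₂ → X) :
    F₂ → _root_.PneNP := by
  intro h₂
  by_contra hS
  exact hS (S_of_X (hasm ⟨h₁ hS, h₂⟩))

/-- **LAW B (theorem leakage).** If one piece already implies `X` by a landed theorem, every partner is
idle: the piece assembles with `True` — criterion (a) fails for the partner and the piece is at least `X`. -/
theorem lawB_theorem_leakage {F₁ : Prop} (h : F₁ → X) (F₂ : Prop) : F₁ ∧ F₂ → X := fun hp => h hp.1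

theorem lawB_partner_idle {F₁ : Prop} (h : F₁ → X) : F₁ ∧ True → X := lawB_theorem_leakage h True

/-- **LAW C (equivalence leakage).** A piece with a landed `iff` to `X` assembles with `True` and is
rejected by criterion (c) outright. -/
theorem lawC_equivalence_leakage {F₁ : Prop} (h : F₁ ↔ X) : F₁ ∧ True → X := fun hp => h.1 hp.1

/-- **LAW D (the weakest partner is the seam).** For any first piece `F`, the partner `F → X` always
completes the decomposition, it is the WEAKEST partner (every other partner implies it), and when `F`
is a consequence of `X` it is literally `X ∨ ¬F` — a statement with no content independent of `X`.
The whole assembly of the pair `{F, F → X}` is one application (`seam`). -/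
theorem lawD_weakest_partner (F F₂ : Prop) (hasm : F ∧ F₂ → X) : F₂ → (F → X) :=
  (law0_normal_form F F₂).1 hasm

theorem seam (F : Prop) : F ∧ (F → X) → X := fun hp => hp.2 hp.1

theorem partner_is_X_or_not (F : Prop) : (F → X) ↔ (X ∨ ¬ F) := by
  constructor
  · intro h
    by_cases hF : F
    · exact Or.inl (h hF)
    · exact Or.inr hF
  · rintro (hX | hnF) hF
    · exact hX
    · exact (hnF hF).elim

/-- When the first piece is a consequence of `X`, the pair `{F, F → X}` is exactly as strong as `X`. -/
theorem pair_iff_X (F : Prop) (hF : X → F) : (F ∧ (F → X)) ↔ X :=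
  ⟨seam F, fun hX => ⟨hF hX, fun _ => hX⟩⟩

/-! ## §2 Consequences of `¬ S` (the `P = NP` world of Cook's statement) — inputs to LAW A -/

/-- `¬ PneNP` puts certificate-`NP` inside prelude-`P` (Cook's classes transported along the two proved
model bridges `P_bool_eq_holds`, `NP_bool_eq_holds`). -/
theorem NP_subset_P_of_not_pneNP (hS : ¬ _root_.PneNP) : Nondeterministic.NP ⊆ Classes.P := by
  intro L hL
  have hP : PNPWave0.P Bool = Classes.P := P_bool_eq_holds
  have hN : PNPWave0.NP Bool = Nondeterministic.NP := NP_bool_eq_holds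
  have hLP : L ∈ PNPWave0.P Bool := by
    by_contra hL'
    exact hS ⟨L, hN ▸ hL, hL'⟩
  exact hP ▸ hLP

/-- … hence `NP ⊆ P/poly` (so `¬ S → ¬ X`). -/
theorem not_X_of_not_pneNP (hS : ¬ _root_.PneNP) : ¬ X :=
  fun hX => hX (fun _ hL => P_subset_PPoly_holds (NP_subset_P_of_not_pneNP hS hL))

/-- … hence `PH ⊆ P` (Arora–Barak Thm 5.4, landed as `SigmaP_subset_P_of_NP_subset_P`). -/
theorem PH_subset_P_of_not_pneNP (hS : ¬ _root_.PneNP) : PH ⊆ Classes.P := by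
  intro L hL
  obtain ⟨k, hk⟩ := Set.mem_iUnion.1 hL
  exact Summit.PneNP.PneNP.Theorems.SigmaP_subset_P_of_NP_subset_P (NP_subset_P_of_not_pneNP hS) k hk

/-- … hence `BPP ⊆ P` (Sipser–Gács–Lautemann `BPP ⊆ Σ₂ᵖ`, landed). The piece "`P = BPP`" holds in
every `P = NP` world. -/
theorem BPP_subset_P_of_not_pneNP (hS : ¬ _root_.PneNP) : BPP ⊆ Classes.P :=
  fun _ hL => PH_subset_P_of_not_pneNP hS (SigmaP_subset_PH 2 (BPP_subset_SigmaP_two hL))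

/-- … hence `EXP ⊄ P/poly` (Meyer's theorem `EXP ⊆ P/poly → EXP = Σ₂ᵖ`, landed as
`EXP_eq_SigmaP_two_of_subset_PPoly_holds`, plus the time hierarchy in the form `P ≠ EXP`, taken as a
hypothesis exactly as in `Literature.Barriers.PneNP.MCSPHardnessObstructionsScope`). -/
theorem not_EXP_subset_PPoly_of_not_pneNP (hPEXP : Classes.P ≠ EXP) (hS : ¬ _root_.PneNP) :
    ¬ (EXP ⊆ PPoly) := by
  intro hE
  apply hPEXP
  apply Set.Subset.antisymm P_subset_EXP
  intro L hL
  have hE2 : EXP = SigmaP 2 := EXP_eq_SigmaP_two_of_subset_PPoly_holds hE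
  rw [hE2] at hL
  exact PH_subset_P_of_not_pneNP hS (SigmaP_subset_PH 2 hL)

/-- … hence crux #4 of the route, `CircuitNexpNotPpoly = ¬ (NEXP ⊆ P/poly)`, HOLDS in every `P = NP`
world (given `P ≠ EXP`).  By LAW A, any partner completing #4 to `X` decides the summit on its own. -/
theorem circuitNexpNotPpoly_of_not_pneNP (hPEXP : Classes.P ≠ EXP) (hS : ¬ _root_.PneNP) :
    Circuit2.CircuitNexpNotPpoly :=
  fun hN => not_EXP_subset_PPoly_of_not_pneNP hPEXP hS (fun _ hL => hN (EXP_subset_NEXP hL))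

/-- LAW A instantiated: a decomposition `#4 ∧ F₂ → X` makes `F₂` summit-strength. -/
theorem partner_of_nexp_decides_summit (hPEXP : Classes.P ≠ EXP) {F₂ : Prop}
    (hasm : Circuit2.CircuitNexpNotPpoly ∧ F₂ → X) : F₂ → _root_.PneNP :=
  lawA_summit_leakage (circuitNexpNotPpoly_of_not_pneNP hPEXP) hasm

/-- LAW A instantiated: a decomposition `(EXP ⊄ P/poly) ∧ F₂ → X` makes `F₂` summit-strength. -/
theorem partner_of_exp_decides_summit (hPEXP : Classes.P ≠ EXP) {F₂ : Prop}
    (hasm : (¬ (EXP ⊆ PPoly)) ∧ F₂ → X) : F₂ → _root_.PneNP :=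
  lawA_summit_leakage (not_EXP_subset_PPoly_of_not_pneNP hPEXP) hasm

/-- LAW A instantiated: a decomposition `(BPP ⊆ P) ∧ F₂ → X` ("derandomisation + something") makes
`F₂` summit-strength. -/
theorem partner_of_derandomisation_decides_summit {F₂ : Prop}
    (hasm : (BPP ⊆ Classes.P) ∧ F₂ → X) : F₂ → _root_.PneNP :=
  lawA_summit_leakage BPP_subset_P_of_not_pneNP hasm

/-- LAW A instantiated: a decomposition `(PH ⊆ P ∨ X) ∧ F₂ → X` … more generally ANY piece of the
form "`¬X →` (a consequence of `P = NP`)" triggers the law; recorded for the uniform pieces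
`NP ⊄ BPP`, `NP ⊄ P/log`, `Σ₂ᵖ ≠ P^NP`, … of the census, whose NEGATIONS follow from `¬ S`. -/
theorem partner_of_PeqNP_consequence_decides_summit {K F₂ : Prop} (hK : ¬ _root_.PneNP → K)
    (hasm : K ∧ F₂ → X) : F₂ → _root_.PneNP :=
  lawA_summit_leakage hK hasm

/-! ## §3 Pieces that are AT LEAST `X` by a landed theorem (LAW B) -/

/-- #2 `MCSP ∉ P/poly → X` (landed glue `circuitMcspGlue_proof`). -/
theorem X_of_mcspNotPpoly : Circuit2.CircuitMcspNotPpoly → X :=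
  Summit.PneNP.PneNP.Theorems.circuitMcspGlue_proof

/-- #5R (circuit-form hardness magnification frontier) `→ X` (landed glue
`circuitMagnificationGlue_proof`, resting on the formalised MMW19 Thm 1.4). -/
theorem X_of_magnificationFrontierR : Circuit2.CircuitMagnificationFrontierR → X :=
  Summit.PneNP.PneNP.Theorems.circuitMagnificationGlue_proof

/-- `PH ≠ Σ₂ᵖ → X` (Karp–Lipton, landed as `KarpLipton.PH_eq_SigmaP_two_of_NP_subset_PPoly`). -/
theorem X_of_PH_ne_SigmaP_two (h : PH ≠ SigmaP 2) : X :=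
  fun hsub => h (KarpLipton.PH_eq_SigmaP_two_of_NP_subset_PPoly hsub)

/-- `2^{n^ε}`-hard PRGs `→ X` (Razborov–Rudich + Kabanets–Cai direction, landed). -/
theorem X_of_hardPRG (h : Literature.Barriers.PneNP.HardPRGExist) : X :=
  Literature.Barriers.PneNP.HardPRGExist.not_NP_subset_PPoly h

/-- Non-uniformly secure one-way functions `→ X` (landed). -/
theorem X_of_nonuniformOWF (h : Literature.Computability.Cryptography.NonuniformOWFExist) : X :=
  Literature.Computability.Cryptography.NP_not_subset_PPoly_of_NonuniformOWFExist h

/-- LAW B instantiated on the five: each assembles with an idle partner. -/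
theorem lawB_instances :
    (Circuit2.CircuitMcspNotPpoly ∧ True → X) ∧
    (Circuit2.CircuitMagnificationFrontierR ∧ True → X) ∧
    ((PH ≠ SigmaP 2) ∧ True → X) ∧
    (Literature.Barriers.PneNP.HardPRGExist ∧ True → X) ∧
    (Literature.Computability.Cryptography.NonuniformOWFExist ∧ True → X) :=
  ⟨lawB_partner_idle X_of_mcspNotPpoly, lawB_partner_idle X_of_magnificationFrontierR,
    lawB_partner_idle X_of_PH_ne_SigmaP_two, lawB_partner_idle X_of_hardPRG,
    lawB_partner_idle X_of_nonuniformOWF⟩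

/-! ## §4 Pieces EQUIVALENT to `X` by a landed iff (criterion (c)) -/

theorem NP_subset_PH : Nondeterministic.NP ⊆ PH := by
  intro L hL
  rw [← SigmaP_one_holds] at hL
  exact SigmaP_subset_PH 1 hL

/-- `X ↔ SAT ∉ P/poly` (landed `NP_subset_PPoly_iff_SAT_mem_PPoly`, Cook–Levin + closure of P/poly). -/
theorem X_iff_SAT : X ↔ SAT ∉ PPoly := not_congr NP_subset_PPoly_iff_SAT_mem_PPoly

/-- `X ↔ PH ⊄ P/poly` (landed `PH_subset_PPoly_of_NP_subset_PPoly` + `NP ⊆ PH`). -/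
theorem X_iff_PH : X ↔ ¬ (PH ⊆ PPoly) :=
  not_congr ⟨PH_subset_PPoly_of_NP_subset_PPoly, fun h _ hL => h (NP_subset_PH hL)⟩

/-- `X ↔ Σ₂ᵖ ⊄ P/poly` (same collapse one level up). -/
theorem X_iff_SigmaP_two : X ↔ ¬ (SigmaP 2 ⊆ PPoly) :=
  not_congr ⟨fun h => SigmaP_subset_PPoly_of_NP_subset_PPoly h 2,
    fun h _ hL => h ((NP_subset_SigmaP_two_inter_PiP_two hL).1)⟩

/-- `X ↔ ¬ CircuitNeg` (the route's kill-switch item, by `Iff.rfl`). -/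
theorem X_iff_not_circuitNeg : X ↔ ¬ Circuit.CircuitNeg := Iff.rfl

/-- `X` is `rfl`-equal to both registered `NP ⊄ P/poly` constants. -/
theorem X_iff_literature_constant : X ↔ Literature.Computability.Complexity.NPNotSubsetPPoly := Iff.rfl

theorem X_iff_sibling_route_constant : X ↔ Circuit.CircuitThesis := Iff.rfl

/-! ## §5 Admissible first pieces (strict consequences of `X`) and their seam partners -/

/-- `X →` #4′ of route `circuit`: the Kannan-form fixed-polynomial bound for NP (landed lemma). -/
theorem fixedPoly_of_X (hX : X) : Circuit.CircuitFixedPoly :=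
  exists_mem_NP_not_mem_SIZE_of_not_subset hX

/-- `X → NP ⊄ TC⁰` (route `circuit` #5; `TC⁰ ⊆ NC¹ ⊆ P/poly`, landed). -/
theorem npTc0_of_X (hX : X) : Circuit.CircuitNpTc0 :=
  fun h => hX (fun _ hL => NC1_subset_PPoly (TC0_subset_NC1_holds (h hL)))

/-- `X → NP ⊄ ACC⁰` (route `circuit` #3; `ACC⁰ ⊆ P/poly`, landed). -/
theorem npAcc0_of_X (hX : X) : Circuit.CircuitNpAcc0 :=
  fun h => hX (fun _ hL => ACC0_subset_PPoly (h hL))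

/-- `X →` #4 `NEXP ⊄ P/poly` (`NP ⊆ EXP ⊆ NEXP`, landed). -/
theorem nexp_of_X (hX : X) : Circuit2.CircuitNexpNotPpoly :=
  fun h => hX (fun _ hL => h (EXP_subset_NEXP (NP_subset_EXP_holds hL)))

/-- `X →` #3 `SAT ∉ SIZE(c·n² + c)` for every `c` (via `X ↔ SAT ∉ P/poly` and `SIZE ⊆ P/poly`). -/
theorem satQuadratic_of_X (hX : X) : Circuit2.CircuitSatQuadraticSize := by
  intro hmem
  obtain ⟨c, hc⟩ := Set.mem_iUnion.1 hmem
  refine (X_iff_SAT.1 hX) ?_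
  refine SIZE_subset_PPoly (Polynomial.C c * Polynomial.X ^ 2 + Polynomial.C c) (fun n => ?_) hc
  simp

/-- The seam partners, by name: for each admissible piece `F` the minimal completion is `F → X`, the
assembly is `seam F` (one application), and the pair is exactly as strong as `X` (`pair_iff_X`). -/
theorem seam_partners :
    ((Circuit.CircuitFixedPoly ∧ (Circuit.CircuitFixedPoly → X)) ↔ X) ∧
    ((Circuit.CircuitNpTc0 ∧ (Circuit.CircuitNpTc0 → X)) ↔ X) ∧
    ((Circuit.CircuitNpAcc0 ∧ (Circuit.CircuitNpAcc0 → X)) ↔ X) ∧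
    ((Circuit2.CircuitNexpNotPpoly ∧ (Circuit2.CircuitNexpNotPpoly → X)) ↔ X) ∧
    ((Circuit2.CircuitSatQuadraticSize ∧ (Circuit2.CircuitSatQuadraticSize → X)) ↔ X) :=
  ⟨pair_iff_X _ fixedPoly_of_X, pair_iff_X _ npTc0_of_X, pair_iff_X _ npAcc0_of_X,
    pair_iff_X _ nexp_of_X, pair_iff_X _ satQuadratic_of_X⟩

/-- The "fixed-polynomial amplification" partner spelled out in words of its own
(`NP ⊆ P/poly → ∃ k, NP ⊆ SIZE(O(n^k))`) is the seam partner of `CircuitFixedPoly` verbatim: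
its assembly is four lines of first-order logic and touches no theorem. -/
def FixedPolyAmplification : Prop :=
  Nondeterministic.NP ⊆ PPoly → ∃ k : ℕ, Nondeterministic.NP ⊆ ⋃ c : ℕ, SIZE (fun n => c * n ^ k + c)

theorem assembly_fixedPoly (h₁ : Circuit.CircuitFixedPoly) (h₂ : FixedPolyAmplification) : X := by
  intro hsub
  obtain ⟨k, hk⟩ := h₂ hsub
  obtain ⟨L, hL, hLk⟩ := h₁ k
  exact hLk (hk hL)

theorem fixedPolyAmplification_iff_seam : FixedPolyAmplification ↔ (Circuit.CircuitFixedPoly → X) := by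
  constructor
  · exact fun h₂ h₁ => assembly_fixedPoly h₁ h₂
  · intro h hsub
    by_contra hk
    exact h (fun k => by
      obtain ⟨L, hL, hLk⟩ := Set.not_subset.1 (not_exists.mp hk k)
      exact ⟨L, hL, hLk⟩) hsub

/-- The "depth collapse" partner of `NP ⊄ TC⁰` (`NP ⊆ P/poly → NP ⊆ TC⁰`) is likewise its seam partner. -/
def DepthCollapseTC0 : Prop :=
  Nondeterministic.NP ⊆ PPoly → Nondeterministic.NP ⊆ TC0

theorem depthCollapseTC0_iff_seam : DepthCollapseTC0 ↔ (Circuit.CircuitNpTc0 → X) :=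
  ⟨fun h₂ h₁ hsub => h₁ (h₂ hsub), fun h hsub => by
    by_contra h'
    exact h h' hsub⟩

/-! ## §6 Squeeze register: landed collapse-consequences of `¬ X` and the jaw each would need -/

/-- Under `¬ X`: (i) `PH ⊆ P/poly`; (ii) `PH = Σ₂ᵖ`; (iii) no non-uniform one-way functions; (iv) no
`2^{n^ε}`-hard PRGs; (v) `MCSP[s] ∈ SIZE(N·s(⌊log₂N⌋)^c + c)` for some `c`, for EVERY `s ≥ n` (MMW19
Thm 1.4, formalised).  The lower-bound jaw closing (i)/(ii) is `≡ X` resp. `≥ X` (§4, §3); the jaw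
closing (iii)/(iv) is `≥ X` (§3); the jaw closing (v) for one admissible `s` is #5R, `≥ X` (§3). -/
theorem squeeze_register (hnX : ¬ X) :
    PH ⊆ PPoly ∧ PH = SigmaP 2 ∧
    ¬ Literature.Computability.Cryptography.NonuniformOWFExist ∧
    ¬ Literature.Barriers.PneNP.HardPRGExist ∧
    (∀ s : ℕ → ℕ, (∀ n, n ≤ s n) →
      ∃ c : ℕ, Literature.Computability.MetaComplexity.MCSPSize s ∈
        SIZE (fun N => N * s (Nat.log 2 N) ^ c + c)) := by
  have hsub : Nondeterministic.NP ⊆ PPoly := by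
    by_contra h
    exact hnX h
  refine ⟨PH_subset_PPoly_of_NP_subset_PPoly hsub, KarpLipton.PH_eq_SigmaP_two_of_NP_subset_PPoly hsub,
    Literature.Computability.Cryptography.not_NonuniformOWFExist_of_NP_subset_PPoly hsub,
    Literature.Barriers.PneNP.not_hardPRGExist_of_NP_subset_PPoly hsub, ?_⟩
  intro s hs
  by_contra hc
  exact Literature.Computability.MetaComplexity.MckayMurrayWilliams2019_thm14_holds s hs
    (fun c hc' => hc ⟨c, hc'⟩) hsub

/-- Kannan's theorem (landed) is the solved SIBLING of the fixed-polynomial jaw: `Σ₂ᵖ ∩ Π₂ᵖ` has, for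
every `k`, a language outside `SIZE(c·n^k + c)` for all `c`.  Under `¬ X` this language lies in
`PH = Σ₂ᵖ ⊆ P/poly` — no contradiction: the squeeze never closes on NP (see `## Transfer`). -/
theorem kannan_sibling : ∀ k : ℕ, ∃ L ∈ SigmaP 2 ∩ PiP 2, L ∉ ⋃ c : ℕ, SIZE (fun n => c * n ^ k + c) :=
  kannan_holds

theorem kannan_consistent_with_not_X (hnX : ¬ X) (k : ℕ) :
    ∃ L ∈ PPoly, L ∉ ⋃ c : ℕ, SIZE (fun n => c * n ^ k + c) := by
  obtain ⟨L, hL, hLk⟩ := kannan_holds k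
  have hsub : Nondeterministic.NP ⊆ PPoly := by
    by_contra h
    exact hnX h
  exact ⟨L, SigmaP_subset_PPoly_of_NP_subset_PPoly hsub 2 hL.1, hLk⟩

/-! ## §7 Case splits with k ≥ 3 pieces bottom out in the summit -/

/-- "Converse Karp–Lipton" (collapse all the way to `P`): `NP ⊆ P/poly → P = NP` in the form the
summit statement can consume.  Admissible as a piece (it is `X ∨ ¬S`: implied by `X`, consistent with
`P = NP`), but it is the seam partner of the SUMMIT itself. -/
def ConverseKarpLipton : Prop :=
  Nondeterministic.NP ⊆ PPoly → ¬ _root_.PneNP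

/-- `X` is exactly "the summit plus converse Karp–Lipton". -/
theorem X_iff_S_and_converseKL : X ↔ (_root_.PneNP ∧ ConverseKarpLipton) :=
  ⟨fun hX => ⟨S_of_X hX, fun hsub => (hX hsub).elim⟩, fun h hsub => h.2 hsub h.1⟩

/-- Splitting the summit along ANY dichotomy `D` is propositional … -/
theorem S_iff_split (D : Prop) :
    _root_.PneNP ↔ ((¬ _root_.PneNP → D) ∧ (¬ _root_.PneNP → ¬ D)) := by
  constructor
  · exact fun hS => ⟨fun h => (h hS).elim, fun h => (h hS).elim⟩
  · rintro ⟨h₁, h₂⟩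
    by_contra hS
    exact h₂ hS (h₁ hS)

/-- … so the generic three-piece decomposition `{ConverseKarpLipton, ¬S → D, ¬S → ¬D}` of `X` passes
every cheap probe for `D` independent of `P` vs `NP` (no piece is `≡ X`, `≡ S`, `≥ X` or `≥ S`) and
is nevertheless the summit cut along two trivial seams: its assembly is the five lines below. -/
theorem three_piece_seam (D : Prop) :
    (ConverseKarpLipton ∧ (¬ _root_.PneNP → D) ∧ (¬ _root_.PneNP → ¬ D)) ↔ X := by
  constructor
  · rintro ⟨hc, h₁, h₂⟩ hsub
    exact hc hsub ((S_iff_split D).2 ⟨h₁, h₂⟩)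
  · intro hX
    exact ⟨fun hsub => (hX hsub).elim, fun h => (h (S_of_X hX)).elim, fun h => (h (S_of_X hX)).elim⟩

end Summit.PneNP.PneNP.Cruxes.CircuitThesis.StrategyCensus
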